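import Summits.BirchSwinnertonDyer.BirchSwinnertonDyer.Theorems.KolyvaginDepthDoorDepthTableKuriharaDecisive655a1
import Summits.BirchSwinnertonDyer.Rank1Residual.Supersingular.CountPointsFast
import HarnessLib

/-!
# Route `KolyvaginDepthDoor`, crux `KolyvaginDepthSupplyKN` (stmt-BirchSwinnertonDyer-22820) —
# DEPTH TABLE v20, ROW `655a1` @ `(11, d_K = -51)`: a SECOND decisive prime `617` and the AGREEMENT test `89 ↔ 617`

Helper file of the lead prover of line `levelone` (kdd-p1 g24; `--supports stmt-BirchSwinnertonDyer-22820
--as helper`); it closes nothing and BSD is NOT proved by it. Same template as `…KuriharaDecisive709a1B` (second prime +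
agreement) on top of `…KuriharaDecisive655a1` (this generation: exact reading / decisive prime `89` for the tree's twist point
on `T₀ = [0, 0, 1, -33813, -2420881]`).

* `twistKuriharaBit_iff_unit_617` — **bit ⟺ unit `δ̃_617(T₀)`** (`#T̃₀(𝔽_617) = 594 = 11·54`, `a_617(T₀) = 24 ≡ 2 (mod 11)`,
  `P̄ = (244, 289)`, `54 • P̄ = (252, 616) ≠ O` by a 8-step chain, `decide`).
* `unit_89_iff_unit_617` — the AGREEMENT test: modulo print, `δ̃_89(T₀)` is a unit ⟺ `δ̃_617(T₀)` is; two residues that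
  disagree contradict the named print facts or the engine (falsifiable with two residues at level `N_{T₀} = 1703655`).

CONDITIONAL on the named facts displayed and the E-side record claim `hδE`; per curve; nothing class-wide; BSD is NOT proved by
any of this.

References: [Sakamoto2022pSelmer] Lemma 4.4, Lemma 4.6 (1), Thm. 1.2, Thm. 1.5; [Kim2022StructureSelmer] Thm. 1.11, §1.2.2;
[SilvermanAEC2009] III.2.3, VII.2.1, VII.3.1; [CremonaAlgorithms1997] Table 1 (655a1).
-/

set_option linter.dupNamespace false

noncomputable section

open scoped Classical NumberField

namespace Summit.BirchSwinnertonDyer.BirchSwinnertonDyer.Theorems.KolyvaginDepthDoor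

open Literature.NumberTheory.EllipticCurves Literature.NumberTheory.EllipticCurves.ModularForms
  WeierstrassCurve NumberField IsDedekindDomain
open Summit.BirchSwinnertonDyer.BirchSwinnertonDyer.Theorems
open Summit.BirchSwinnertonDyer.BirchSwinnertonDyer.Rank2Observatory
open Summit.BirchSwinnertonDyer.BirchSwinnertonDyer.Rank1Residual (IntModel.frobeniusTrace_eq)
open Summit.BirchSwinnertonDyer.Rank1Residual.Supersingular (natCard_point_eq_of_countPoints countPoints_eq_of_fast)
open Summit.BirchSwinnertonDyer.Rank1Residual.Additive (card_torsion_le_of_intModel_of_card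
  isKolyvaginPrime_of_intModel_of_card)

namespace C655a1

/-! ## §1 Kernel: the second decisive prime `617` -/

/-- `#T̃₀(𝔽_617) = 594 = 11·54` for `T₀ = [0, 0, 1, -33813, -2420881]` (`617 ≡ 1 (mod 11)`, `a_617(T₀) = 24 ≡ 2 (mod 11)`, `11² ∤ 594`),
kernel-decided (`countPointsFast`). [cite: Kim2022StructureSelmer, §1.2.2 (PDF p. 5)] -/
theorem minTwist51_card_617 :
    Nat.card (((⟨0, 0, 1, -33813, -2420881⟩ : WeierstrassCurve ℤ).map (Int.castRingHom (ZMod 617))).toAffine.Point) = 594 :=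
  haveI : Fact (Nat.Prime 617) := ⟨by norm_num⟩
  natCard_point_eq_of_countPoints 0 0 1 (-33813) (-2420881) 617 (by norm_num) (by decide +kernel) (n := 594)
    (countPoints_eq_of_fast (by decide +kernel))

/-- **`617` is a CYCLIC KOLYVAGIN PRIME for `(T₀, 11)`** (`617 ∤ 11·N_{T₀}`, `617 ≡ 1`, `a_617(T₀) ≡ 2 (mod 11)`, `#T̃₀(𝔽_617)[11] ≤ 11`).
[cite: Kim2022StructureSelmer, §1.2.2 (PDF p. 5)] -/
theorem minTwist51_isCyclicKolyvaginLevel_11_617 :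
    haveI := minTwist51_isGloballyMinimal; haveI := Fact.mk (by norm_num : Nat.Prime 11);
    IsCyclicKolyvaginLevel ((⟨0, 0, 1, -33813, -2420881⟩ : WeierstrassCurve ℤ).map (Int.castRingHom ℚ)) 11 617 := by
  haveI := minTwist51_isElliptic
  haveI := minTwist51_isGloballyMinimal
  haveI := Fact.mk (by norm_num : Nat.Prime 11)
  haveI : Fact (Nat.Prime 617) := ⟨by norm_num⟩
  have hℓ : Kato.IsKolyvaginPrime ((⟨0, 0, 1, -33813, -2420881⟩ : WeierstrassCurve ℤ).map (Int.castRingHom ℚ)) 11 1 617 :=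
    isKolyvaginPrime_of_intModel_of_card minTwist51_intModel 11 1 617 (by norm_num) (by decide +kernel) (by decide)
      minTwist51_card_617 (by norm_num)
  refine ⟨⟨Nat.squarefree_iff_nodup_primeFactorsList (by norm_num) |>.mpr (by simp), fun ℓ hℓ' ↦ ?_⟩, fun ℓ hℓ' hdvd ↦ ?_⟩
  · rw [show (617 : ℕ).primeFactors = {617} from (Nat.Prime.primeFactors (by norm_num)), Finset.mem_singleton] at hℓ'
    exact hℓ' ▸ hℓ
  · obtain rfl := (Nat.prime_dvd_prime_iff_eq hℓ'.out (by norm_num)).mp hdvd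
    exact card_torsion_le_of_intModel_of_card minTwist51_intModel 11 617 minTwist51_card_617 (by norm_num)

/-- The double-and-add chain from `P̄` reaches the multiplier `54`. [folklore] -/
theorem chain617_mult :
    chainMult 1 [(true, ((437 : ℤ) : ZMod 617), ((188 : ℤ) : ZMod 617)), (false, ((382 : ℤ) : ZMod 617), ((6 : ℤ) : ZMod 617)), (true, ((489 : ℤ) : ZMod 617), ((350 : ℤ) : ZMod 617)), (true, ((100 : ℤ) : ZMod 617), ((235 : ℤ) : ZMod 617)), (false, ((572 : ℤ) : ZMod 617), ((204 : ℤ) : ZMod 617)), (true, ((375 : ℤ) : ZMod 617), ((336 : ℤ) : ZMod 617)), (false, ((70 : ℤ) : ZMod 617), ((234 : ℤ) : ZMod 617)), (true, ((252 : ℤ) : ZMod 617), ((616 : ℤ) : ZMod 617))] = 54 := by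
  decide

/-- The double-and-add chain from `P̄ = (244, 289)` to `54 • P̄ = (252, 616)` in `T̃₀(𝔽_617)` CHECKS (tangent / chord
certificates, `decide`). [cite: SilvermanAEC2009, III.2.3] -/
theorem chain617_ok :
    chainB (⟨0, 0, 1, -33813, -2420881⟩ : WeierstrassCurve ℤ) 617 (((244 : ℤ)) : ZMod 617) (((289 : ℤ)) : ZMod 617)
      ((((244 : ℤ)) : ZMod 617), (((289 : ℤ)) : ZMod 617))
      [(true, ((437 : ℤ) : ZMod 617), ((188 : ℤ) : ZMod 617)), (false, ((382 : ℤ) : ZMod 617), ((6 : ℤ) : ZMod 617)), (true, ((489 : ℤ) : ZMod 617), ((350 : ℤ) : ZMod 617)), (true, ((100 : ℤ) : ZMod 617), ((235 : ℤ) : ZMod 617)), (false, ((572 : ℤ) : ZMod 617), ((204 : ℤ) : ZMod 617)), (true, ((375 : ℤ) : ZMod 617), ((336 : ℤ) : ZMod 617)), (false, ((70 : ℤ) : ZMod 617), ((234 : ℤ) : ZMod 617)), (true, ((252 : ℤ) : ZMod 617), ((616 : ℤ) : ZMod 617))] = true := by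
  decide +kernel

/-- **KERNEL: `P = (3844729/16, 7538734893/64)` is not divisible by `11` in `T₀(ℚ_617)`** — the chain certifies `54 • P̄ ≠ O` in
`T̃₀(𝔽_617)` for the reduction `P̄ = (244, 289)`, `11·54 = #T̃₀(𝔽_617)`, and `localNondivisible_of_chainB_rat`.
[cite: SilvermanAEC2009, III.2.3, VII.2 Prop. 2.1, VII.3 Prop. 3.1] -/
theorem minTwist51_localNondivisible_617 :
    haveI : Fact (Nat.Prime 617) := ⟨by norm_num⟩;
    ∀ Q : (((⟨0, 0, 1, -33813, -2420881⟩ : WeierstrassCurve ℤ).map (Int.castRingHom ℚ)).baseChange ℚ_[617]).toAffine.Point,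
      11 • Q ≠ WeierstrassCurve.Affine.Point.map (W' := ((⟨0, 0, 1, -33813, -2420881⟩ : WeierstrassCurve ℤ).map (Int.castRingHom ℚ)).toAffine)
        (S := ℚ) (Algebra.ofId ℚ ℚ_[617]) (.some ((3844729 : ℚ) / 16) ((7538734893 : ℚ) / 64) minTwist51_nonsingular_P) := by
  haveI : Fact (Nat.Prime 617) := ⟨by norm_num⟩
  have hq : ¬ ((617 : ℕ) : ℤ) ∣ (⟨0, 0, 1, -33813, -2420881⟩ : WeierstrassCurve ℤ).Δ := by decide +kernel
  have hx : ¬ (617 : ℕ) ∣ (((3844729 : ℚ) / 16)).den := by decide +kernel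
  have hy : ¬ (617 : ℕ) ∣ (((7538734893 : ℚ) / 64)).den := by decide +kernel
  have hm : ((617 : ℕ) : ℤ) ∣ (((3844729 : ℚ) / 16)).num - (244 : ℤ) * (((3844729 : ℚ) / 16)).den := by decide +kernel
  have hm' : ((617 : ℕ) : ℤ) ∣ (((7538734893 : ℚ) / 64)).num - (289 : ℤ) * (((7538734893 : ℚ) / 64)).den := by decide +kernel
  have hpk : 11 * 54 = Nat.card (((⟨0, 0, 1, -33813, -2420881⟩ : WeierstrassCurve ℤ).map (Int.castRingHom (ZMod 617))).toAffine.Point) := by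
    rw [minTwist51_card_617]
  exact localNondivisible_of_chainB_rat (⟨0, 0, 1, -33813, -2420881⟩ : WeierstrassCurve ℤ) 617 hq minTwist51_nonsingular_P hx hy hm hm' hpk
    chain617_mult (by convert chain617_ok)


/-! ## §2 The second decisive prime and the agreement test -/

/-- **ROW `655a1` @ `(11, -51)`: THE SECOND DECISIVE PRIME `617` — bit ⟺ unit `δ̃_617(T₀)`.** For every imaginary quadratic `K`
with `d_K = -51`, granted the named facts displayed and the E-side record claim `hδE`: «some frame, some Kolyvagin PRIME
`ℓ`, some Kolyvagin–Heegner datum of conductor `ℓ` with `c_1(ℓ) ≠ 0`» (the depth-table bit) holds IF AND ONLY IF «every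
datum `D` of `T₀` at level `N_{T₀}` with `11 ∤ c_D` and the period transfer has a UNIT mod-`11` Kurihara number AT `617`» —
the claim of a future tree record `cert_<T₀>` @ `(11, 617)`. (⟹): bit ⟹ `#Sel_11(E^{(-51)}) ≤ 11` (§1 ∘ v18's twist IFF)
⟹ unit at `617` (`twistKuriharaClaim_prime_of_natCard_selmerGroup_le` with the kernel certificate `minTwist51_localNondivisible_617`);
(⟸): §1 with `m = 617` (`minTwist51_isCyclicKolyvaginLevel_11_617`, `ν(617) = 1`). CONDITIONAL on the named facts and the claim;
per curve; BSD is not proved by it. [cite: Sakamoto2022pSelmer, Lemma 4.4, Lemma 4.6 (1), Thm. 1.2, Thm. 1.5]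
[cite: Kim2022StructureSelmer, Thm. 1.11] [cite: CremonaAlgorithms1997, Table 1 (655a1)] -/
theorem twistKuriharaBit_iff_unit_617
    (h372 : GrossLMS1991.prop37_2_frobeniusCongruence)
    (h84 : Literature.NumberTheory.EllipticCurves.WZhang2014_lemma84_exists_minimal_kolyvaginClass_one_selmerCard)
    (hKim : Kim2022_card_selmerGroup_le_pow_of_kuriharaNumber_ne_zero)
    (hSak1 : Sakamoto2022_card_selmerGroup_eq_pow_of_isDeltaMinimal)
    (hSak2 : Sakamoto2022_exists_cyclicLevel_kuriharaNumber_ne_zero)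
    (hSak3 : Literature.NumberTheory.EllipticCurves.Sakamoto2022_kuriharaNumber_prime_ne_zero_of_localNondivisible)
    (hnf : exists_isNewformOf) (hMaz : mazur_not_dvd_maninConstant_of_odd)
    (K : Type) [Field K] [NumberField K] (hK : IsImaginaryQuadratic K) (hD : NumberField.discr K = -51)
    (hδE : haveI := isElliptic_c655a1; haveI := isGloballyMinimal_c655a1;
      haveI : NeZero (((⟨0, 0, 1, -13, 18⟩ : WeierstrassCurve ℤ).map (Int.castRingHom ℚ)).conductorNorm ℤ) := neZero_conductorNorm_of_isElliptic _;
      haveI := Fact.mk (by norm_num : Nat.Prime 11);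
      ∀ (D : ModularParametrizationData ((⟨0, 0, 1, -13, 18⟩ : WeierstrassCurve ℤ).map (Int.castRingHom ℚ)) (((⟨0, 0, 1, -13, 18⟩ : WeierstrassCurve ℤ).map (Int.castRingHom ℚ)).conductorNorm ℤ)), ¬ ((11 : ℕ) : ℤ) ∣ D.maninConstant →
        (∃ u : ℚ, ‖(u : ℚ_[11])‖ = 1 ∧ ((⟨0, 0, 1, -13, 18⟩ : WeierstrassCurve ℤ).map (Int.castRingHom ℚ)).realPeriodRat = u * plusPeriod D.f) →
        ∃ ψ : (ℓ : ℕ) → (ZMod ℓ)ˣ →* Multiplicative (ZMod 11),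
          (∀ ℓ ∈ (448559 : ℕ).primeFactors, Function.Surjective (ψ ℓ)) ∧ kuriharaNumber D.f 11 448559 ψ ≠ 0) :
    haveI := isElliptic_c655a1; haveI := isGloballyMinimal_c655a1;
    haveI : NeZero (((⟨0, 0, 1, -13, 18⟩ : WeierstrassCurve ℤ).map (Int.castRingHom ℚ)).conductorNorm ℤ) := neZero_conductorNorm_of_isElliptic _;
    haveI := minTwist51_isElliptic; haveI := minTwist51_isGloballyMinimal;
    haveI : NeZero (((⟨0, 0, 1, -33813, -2420881⟩ : WeierstrassCurve ℤ).map (Int.castRingHom ℚ)).conductorNorm ℤ) := neZero_conductorNorm_of_isElliptic _;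
    haveI := Fact.mk (by norm_num : Nat.Prime 11);
    (∃ (Dt : ModularParametrizationData ((⟨0, 0, 1, -13, 18⟩ : WeierstrassCurve ℤ).map (Int.castRingHom ℚ)) (((⟨0, 0, 1, -13, 18⟩ : WeierstrassCurve ℤ).map (Int.castRingHom ℚ)).conductorNorm ℤ)) (β : ℤ)
      (ι : K →+* ℂ) (ℓ : ℕ) (d : KolyvaginHeegnerData Dt β ι ℓ),
      ℓ.Prime ∧ Zhang2014.IsKolyvaginPrime (((⟨0, 0, 1, -13, 18⟩ : WeierstrassCurve ℤ).map (Int.castRingHom ℚ)).conductorNorm ℤ) ((⟨0, 0, 1, -13, 18⟩ : WeierstrassCurve ℤ).map (Int.castRingHom ℚ)) K 11 ℓ ∧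
        d.kolyvaginClass (p := 11) (by norm_num) 1 ≠ 0) ↔
    (∀ (D : ModularParametrizationData ((⟨0, 0, 1, -33813, -2420881⟩ : WeierstrassCurve ℤ).map (Int.castRingHom ℚ))
          (((⟨0, 0, 1, -33813, -2420881⟩ : WeierstrassCurve ℤ).map (Int.castRingHom ℚ)).conductorNorm ℤ)),
        ¬ ((11 : ℕ) : ℤ) ∣ D.maninConstant →
        (∃ u : ℚ, ‖(u : ℚ_[11])‖ = 1 ∧
          ((⟨0, 0, 1, -33813, -2420881⟩ : WeierstrassCurve ℤ).map (Int.castRingHom ℚ)).realPeriodRat = u * plusPeriod D.f) →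
        ∃ ψ : (q : ℕ) → (ZMod q)ˣ →* Multiplicative (ZMod 11),
          (∀ q ∈ (617 : ℕ).primeFactors, Function.Surjective (ψ q)) ∧ kuriharaNumber D.f 11 617 ψ ≠ 0) := by
  haveI := isElliptic_c655a1
  haveI := isGloballyMinimal_c655a1
  haveI iNZ : NeZero (((⟨0, 0, 1, -13, 18⟩ : WeierstrassCurve ℤ).map (Int.castRingHom ℚ)).conductorNorm ℤ) :=
    neZero_conductorNorm_of_isElliptic _
  haveI := minTwist51_isElliptic
  haveI := minTwist51_isGloballyMinimal
  haveI iNZT : NeZero (((⟨0, 0, 1, -33813, -2420881⟩ : WeierstrassCurve ℤ).map (Int.castRingHom ℚ)).conductorNorm ℤ) :=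
    neZero_conductorNorm_of_isElliptic _
  haveI iP := Fact.mk (by norm_num : Nat.Prime 11)
  haveI : Fact (Nat.Prime 617) := ⟨by norm_num⟩
  haveI : NeZero (617 : ℕ) := ⟨by norm_num⟩
  have hsur : ((⟨0, 0, 1, -13, 18⟩ : WeierstrassCurve ℤ).map (Int.castRingHom ℚ)).HasSurjectiveModNGaloisRep ((11 : ℕ) : ℤ) := by
    simpa using hasSurjectiveModNGaloisRep_11
  have hpD : ¬ (((11 : ℕ) : ℤ) ∣ NumberField.discr K) := by rw [hD]; decide
  have hC : (⟨1, (0 : ℚ), (0 : ℚ), -((1 : ℚ) / 2)⟩ : WeierstrassCurve.VariableChange ℚ) • ((⟨0, 0, 1, -33813, -2420881⟩ : WeierstrassCurve ℤ).map (Int.castRingHom ℚ)) =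
      ((⟨0, 0, 1, -13, 18⟩ : WeierstrassCurve ℤ).map (Int.castRingHom ℚ)).quadraticTwist ((NumberField.discr K : ℤ) : ℚ) := by
    rw [hD]; push_cast; exact minTwist51_smul_eq
  have hiff := kolyvaginPrime_iff_twistKuriharaBit_11_neg51 h372 h84 hKim hSak1 hSak2 hnf hMaz K hK hD hδE
  constructor
  · intro hbit D hc hu
    have hT := (natCard_selmerGroup_quadraticTwist_le_iff_kuriharaBit hKim hSak1 hSak2 hnf hMaz _ 11 (by norm_num) goodOrdinary_11.1
      goodOrdinary_11.2 hsur (NumberField.discr_ne_zero K) hpD _ _ hC minTwist51_nonAnomalous_11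
      (minTwist51_kodairaNeron_of_five_le 11 (by norm_num)) 1).mpr (hiff.mp hbit)
    rw [pow_one] at hT
    exact twistKuriharaClaim_prime_of_natCard_selmerGroup_le hSak3 _ 11 (by norm_num) goodOrdinary_11.1 goodOrdinary_11.2 hsur
      (NumberField.discr_ne_zero K) hpD _ _ hC minTwist51_nonAnomalous_11 (minTwist51_kodairaNeron_of_five_le 11 (by norm_num)) hT 617
      minTwist51_isCyclicKolyvaginLevel_11_617 _ minTwist51_localNondivisible_617 D hc hu
  · intro hunit
    refine hiff.mpr fun D hc hu ↦ ?_
    obtain ⟨ψ, hψ, hne⟩ := hunit D hc hu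
    refine ⟨617, inferInstance, minTwist51_isCyclicKolyvaginLevel_11_617, ?_, ψ, hψ, hne⟩
    rw [Nat.Prime.primeFactors (by norm_num), Finset.card_singleton]

/-- **AGREEMENT TEST for row `655a1` @ `(11, -51)`**: modulo the named print facts and the E-side claim, `δ̃_89(T₀)` is a
unit ⟺ `δ̃_617(T₀)` is a unit (each ⟺ the row's bit). Two computed residues that DISAGREE contradict the print facts named or
the engine — an internal consistency test of the fleet at level `N_{T₀} = 1703655`, falsifiable with two residues. CONDITIONAL;
per curve; BSD is not proved by it. [cite: Sakamoto2022pSelmer, Lemma 4.4, Lemma 4.6 (1)] [cite: CremonaAlgorithms1997, Table 1 (655a1)] -/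
theorem unit_89_iff_unit_617
    (h372 : GrossLMS1991.prop37_2_frobeniusCongruence)
    (h84 : Literature.NumberTheory.EllipticCurves.WZhang2014_lemma84_exists_minimal_kolyvaginClass_one_selmerCard)
    (hKim : Kim2022_card_selmerGroup_le_pow_of_kuriharaNumber_ne_zero)
    (hSak1 : Sakamoto2022_card_selmerGroup_eq_pow_of_isDeltaMinimal)
    (hSak2 : Sakamoto2022_exists_cyclicLevel_kuriharaNumber_ne_zero)
    (hSak3 : Literature.NumberTheory.EllipticCurves.Sakamoto2022_kuriharaNumber_prime_ne_zero_of_localNondivisible)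
    (hnf : exists_isNewformOf) (hMaz : mazur_not_dvd_maninConstant_of_odd)
    (K : Type) [Field K] [NumberField K] (hK : IsImaginaryQuadratic K) (hD : NumberField.discr K = -51)
    (hδE : haveI := isElliptic_c655a1; haveI := isGloballyMinimal_c655a1;
      haveI : NeZero (((⟨0, 0, 1, -13, 18⟩ : WeierstrassCurve ℤ).map (Int.castRingHom ℚ)).conductorNorm ℤ) := neZero_conductorNorm_of_isElliptic _;
      haveI := Fact.mk (by norm_num : Nat.Prime 11);
      ∀ (D : ModularParametrizationData ((⟨0, 0, 1, -13, 18⟩ : WeierstrassCurve ℤ).map (Int.castRingHom ℚ)) (((⟨0, 0, 1, -13, 18⟩ : WeierstrassCurve ℤ).map (Int.castRingHom ℚ)).conductorNorm ℤ)), ¬ ((11 : ℕ) : ℤ) ∣ D.maninConstant →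
        (∃ u : ℚ, ‖(u : ℚ_[11])‖ = 1 ∧ ((⟨0, 0, 1, -13, 18⟩ : WeierstrassCurve ℤ).map (Int.castRingHom ℚ)).realPeriodRat = u * plusPeriod D.f) →
        ∃ ψ : (ℓ : ℕ) → (ZMod ℓ)ˣ →* Multiplicative (ZMod 11),
          (∀ ℓ ∈ (448559 : ℕ).primeFactors, Function.Surjective (ψ ℓ)) ∧ kuriharaNumber D.f 11 448559 ψ ≠ 0) :
    haveI := isElliptic_c655a1; haveI := isGloballyMinimal_c655a1;
    haveI : NeZero (((⟨0, 0, 1, -13, 18⟩ : WeierstrassCurve ℤ).map (Int.castRingHom ℚ)).conductorNorm ℤ) := neZero_conductorNorm_of_isElliptic _;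
    haveI := minTwist51_isElliptic; haveI := minTwist51_isGloballyMinimal;
    haveI : NeZero (((⟨0, 0, 1, -33813, -2420881⟩ : WeierstrassCurve ℤ).map (Int.castRingHom ℚ)).conductorNorm ℤ) := neZero_conductorNorm_of_isElliptic _;
    haveI := Fact.mk (by norm_num : Nat.Prime 11);
    (∀ (D : ModularParametrizationData ((⟨0, 0, 1, -33813, -2420881⟩ : WeierstrassCurve ℤ).map (Int.castRingHom ℚ))
          (((⟨0, 0, 1, -33813, -2420881⟩ : WeierstrassCurve ℤ).map (Int.castRingHom ℚ)).conductorNorm ℤ)),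
        ¬ ((11 : ℕ) : ℤ) ∣ D.maninConstant →
        (∃ u : ℚ, ‖(u : ℚ_[11])‖ = 1 ∧
          ((⟨0, 0, 1, -33813, -2420881⟩ : WeierstrassCurve ℤ).map (Int.castRingHom ℚ)).realPeriodRat = u * plusPeriod D.f) →
        ∃ ψ : (q : ℕ) → (ZMod q)ˣ →* Multiplicative (ZMod 11),
          (∀ q ∈ (89 : ℕ).primeFactors, Function.Surjective (ψ q)) ∧ kuriharaNumber D.f 11 89 ψ ≠ 0) ↔
    (∀ (D : ModularParametrizationData ((⟨0, 0, 1, -33813, -2420881⟩ : WeierstrassCurve ℤ).map (Int.castRingHom ℚ))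
          (((⟨0, 0, 1, -33813, -2420881⟩ : WeierstrassCurve ℤ).map (Int.castRingHom ℚ)).conductorNorm ℤ)),
        ¬ ((11 : ℕ) : ℤ) ∣ D.maninConstant →
        (∃ u : ℚ, ‖(u : ℚ_[11])‖ = 1 ∧
          ((⟨0, 0, 1, -33813, -2420881⟩ : WeierstrassCurve ℤ).map (Int.castRingHom ℚ)).realPeriodRat = u * plusPeriod D.f) →
        ∃ ψ : (q : ℕ) → (ZMod q)ˣ →* Multiplicative (ZMod 11),
          (∀ q ∈ (617 : ℕ).primeFactors, Function.Surjective (ψ q)) ∧ kuriharaNumber D.f 11 617 ψ ≠ 0) :=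
  (twistKuriharaBit_iff_unit_89 h372 h84 hKim hSak1 hSak2 hSak3 hnf hMaz K hK hD hδE).symm.trans
    (twistKuriharaBit_iff_unit_617 h372 h84 hKim hSak1 hSak2 hSak3 hnf hMaz K hK hD hδE)

end C655a1

end Summit.BirchSwinnertonDyer.BirchSwinnertonDyer.Theorems.KolyvaginDepthDoor

end
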